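import Summits.CriticalPhenomena.SAWScalingLimit.Theorems.SAWLeftRightFKGFKGToTraversalBoundObstacleTripleLoop
import HarnessLib

/-!
# No bad triple of obstacle contacts along the wall-follower tour (witness unit U5d)

Crux `SAWLeftRightFKG.FKGToTraversalBound` (stmt-CriticalPhenomena-1878), line `slit-necklace`, lead
prover-line-stmt-CriticalPhenomena-1878-c5-0; witness unit U5d, on top of `…SlitNecklaceOutline` (`IsBEdge`,
`bsite`, `bcontact`, `btour`), `…OutlineTour` (`btour_add`, `btour_add_of_eq`, `btour_mod_of_eq`) and the two
parts `…ObstacleTriplePockets` (`triple_pocket_v`, `triple_pocket_u`) and `…ObstacleTripleLoop`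
(`triple_arc_contacts`).

Registered stub `obstacle_noBadTriple`.  Setting: `A ⊆ ℤ²` finite and `4`-connected; `e₀` a boundary edge of `A`
whose wall-follower tour has the injective period `N`; `r : u ⟶ v` a lattice PATH avoiding `A` (a far piece of the
chord, the OBSTACLE), with escapes to the right of a column `Rbig` (right of `A ∪ r`) from `u`, from `v`, and from
every non-`A` neighbour of `A` off the interior of `r`; and the LOCAL STEP PROPERTY of units U5b/U5c as a
hypothesis: two consecutive tour positions whose contacts are interior `r`-vertices `r_n`, `r_{n'}` have `n ≤ n'`,
or form one of the two ENDPOINT WRAPS (through `v = r_L`, resp. through `u = r_0`).  A BAD TRIPLE is a triple of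
positions `x < y < z < x + N` whose contacts are interior `r`-vertices `r_{mx}`, `r_{my'}`, `r_{mz}` with `mx < mz`
and `my' ∉ [mx, mz]`.  Claim: there is none.

Proof.  Shift the period to start at `x` (`btour_add`).  By `triple_arc_contacts` (the loop through the contacts
of `x` and `z`, two tour arcs with different winding numbers, the `y`-contact escaping to the column `Rbig`) every
position `z < j < x + N` has a contact `r_k`, `mx ≤ k ≤ mz`; so does `x + N` (contact `r_{mx}`).  Walking from `z`
(index `mz > mx`) forward, the LAST position `w` with index `> mx` is followed by a position with index exactly
`mx`: by the local step property this step is an endpoint wrap.  A wrap through `v` forces `mz = L - 1` and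
`my' < mx`, and is refuted by the pocket `r[mx .. L]` (`triple_pocket_v`, fed with the `A`-site of position `y`,
adjacent to `r_{my'}`); a wrap through `u` forces `mx = 1` and `my' > mz`, refuted by the pocket `r[0 .. n]`
(`triple_pocket_u`).

All statements folklore (boundary tracing of a polyomino; discrete winding numbers, Kesten, *Percolation theory
for mathematicians* (1982), §2.2); no literature fact is introduced; nothing restates the crux.
-/

noncomputable section

open Set
open Literature.Probability.LatticeModels

namespace Summit.CriticalPhenomena.SAWScalingLimit.Theorems.FKGToTraversalBound.SlitNecklace

/-- **No bad triple, normalised**: the statement of `obstacle_noBadTriple` with the first position of the triple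
at the start `e` of the period (positions `0 < y < z < N`).  Steps: `triple_arc_contacts`; the last descender
`w`; the local step at `w` is a wrap; the two pockets. [folklore] -/
private theorem triple_core (A : Finset (Site 2)) (e : Site 2 × ODir) (N : ℕ) {u v : Site 2}
    (r : (zdGraph 2).Walk u v) (Rbig : ℤ) (u₁ v₁ : Site 2) (εu : (zdGraph 2).Walk u u₁)
    (εv : (zdGraph 2).Walk v v₁) (y z mx my' mz : ℕ) (he : IsBEdge (↑A : Set (Site 2)) e)
    (hN : btour (↑A : Set (Site 2)) e N = e)
    (hinj : ∀ j j', j < N → j' < N → btour (↑A : Set (Site 2)) e j = btour (↑A : Set (Site 2)) e j' → j = j')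
    (hr : r.IsPath) (hA : ∀ x' ∈ A, ∀ y' ∈ A, ∃ w : (zdGraph 2).Walk x' y', ∀ z' ∈ w.support, z' ∈ A)
    (hrA : ∀ z' ∈ r.support, z' ∉ A) (hR : ∀ z' : Site 2, (z' ∈ A ∨ z' ∈ r.support) → z' 0 + 2 ≤ Rbig)
    (hu₁ : Rbig ≤ u₁ 0) (hv₁ : Rbig ≤ v₁ 0)
    (hεu : ∀ z' ∈ εu.support, z' ∉ A ∧ ∀ n, 0 < n → n < r.length → z' ≠ r.getVert n)
    (hεv : ∀ z' ∈ εv.support, z' ∉ A ∧ ∀ n, 0 < n → n < r.length → z' ≠ r.getVert n)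
    (hesc : ∀ c : Site 2, c ∉ A → (∀ n, 0 < n → n < r.length → c ≠ r.getVert n) →
      (∃ a ∈ A, (zdGraph 2).Adj a c) → ∃ (c' : Site 2) (ε : (zdGraph 2).Walk c c'), Rbig ≤ c' 0 ∧
        ∀ z' ∈ ε.support, z' ∉ A ∧ ∀ n, 0 < n → n < r.length → z' ≠ r.getVert n)
    (hstep : ∀ (k n n' : ℕ), 0 < n → n < r.length → 0 < n' → n' < r.length →
      bcontact (btour (↑A : Set (Site 2)) e k) = r.getVert n →
      bcontact (btour (↑A : Set (Site 2)) e (k + 1)) = r.getVert n' →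
      (n ≤ n' ∨ (n + 1 = r.length ∧ n' + 2 ≤ n ∧ ∃ f ∈ A, ∃ d : ODir, r.getVert n = f + d.vec ∧
        r.getVert n' = f + d.ccw.vec ∧ r.getVert r.length = f + d.vec + d.ccw.vec ∧
        r.getVert (n' - 1) = r.getVert n' + d.ccw.vec) ∨ (n' = 1 ∧ 3 ≤ n ∧ ∃ f ∈ A, ∃ d : ODir,
        r.getVert n = f + d.vec ∧ r.getVert 1 = f + d.ccw.vec ∧ r.getVert 0 = f + d.vec + d.ccw.vec ∧
        r.getVert (n + 1) = r.getVert n + d.vec)))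
    (hy0 : 0 < y) (hyz : y < z) (hzN : z < N) (hmx : 0 < mx) (hmy'0 : 0 < my') (hmy'L : my' < r.length)
    (hmzL : mz < r.length) (h0 : bcontact e = r.getVert mx)
    (hy : bcontact (btour (↑A : Set (Site 2)) e y) = r.getVert my')
    (hz : bcontact (btour (↑A : Set (Site 2)) e z) = r.getVert mz) (hxz : mx < mz)
    (hmy' : my' < mx ∨ mz < my') : False := by
  -- every position of the second arc has a contact on `r[mx .. mz]`
  have harc := triple_arc_contacts A e N r Rbig u₁ v₁ εu εv y z mx my' mz he hN hinj hr hA hrA hR hu₁ hv₁ hεu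
    hεv hesc hy0 hyz hzN hmx hmy'L hmzL h0 hy hz hxz hmy'
  -- the last descender: a position `w` with index `> mx` followed by a position with index `mx`
  have hdesc : ∀ t j, j + t + 1 = N → z ≤ j →
      (∃ k, mx < k ∧ k ≤ mz ∧ bcontact (btour (↑A : Set (Site 2)) e j) = r.getVert k) →
      ∃ w n, mx < n ∧ n ≤ mz ∧ bcontact (btour (↑A : Set (Site 2)) e w) = r.getVert n ∧
        bcontact (btour (↑A : Set (Site 2)) e (w + 1)) = r.getVert mx := by
    intro t
    induction t with
    | zero =>
      rintro j hj - ⟨k, hk1, hk2, hk⟩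
      refine ⟨j, k, hk1, hk2, hk, ?_⟩
      rw [show j + 1 = N by omega, hN, h0]
    | succ t ih =>
      rintro j hj hzj ⟨k, hk1, hk2, hk⟩
      obtain ⟨k', hk'1, hk'2, hk'⟩ := harc (j + 1) (by omega) (by omega)
      rcases Nat.eq_or_lt_of_le hk'1 with h | h
      · exact ⟨j, k, hk1, hk2, hk, by rw [hk', h]⟩
      · exact ih (j + 1) (by omega) (by omega) ⟨k', h, hk'2, hk'⟩
  obtain ⟨w, n, hn1, hn2, hwn, hwmx⟩ := hdesc (N - z - 1) z (by omega) le_rfl ⟨mz, hxz, le_rfl, hz⟩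
  have hey := bcontact_spec _ (btour_isBEdge (↑A : Set (Site 2)) he y)
  have hadj : (zdGraph 2).Adj (bsite (btour (↑A : Set (Site 2)) e y)) (r.getVert my') := hy ▸ hey.2.2
  -- the local step at `w` cannot be monotone, so it is an endpoint wrap; both pockets are refuted via `y`
  rcases hstep w n mx (by omega) (by omega) hmx (by omega) hwn hwmx with
    h | ⟨hnL, hmxn, f, hf, d, -, hfmx, hfL, hfmx1⟩ | ⟨hmx1, hn3, f, hf, d, hfn, -, hf0, hfn1⟩
  · omega
  · exact triple_pocket_v A r f _ d mx my' hr hrA hA hf hey.1 hadj (by omega) (by omega) hfmx hfL hfmx1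
  · exact triple_pocket_u A r f _ d n my' hr hrA hA hf hey.1 hadj (by omega) hmy'L.le hn3 hfn hf0 hfn1

/-- **Registered stub (witness unit U5d): no bad triple of obstacle contacts along the wall-follower tour.**
Along one injective period of the tour of the `4`-connected site set `A`, given the obstacle path `r` avoiding `A`,
escapes to the right from its endpoints and from every non-`A` neighbour of `A` off the interior of `r`, and the
local step property (unit U5b/U5c) as a hypothesis, there are no positions `x < y < z < x + N` whose contacts are
interior `r`-vertices `r_{mx}`, `r_{my'}`, `r_{mz}` with `mx < mz` and `my' ∉ [mx, mz]`.  Proof: shift the period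
to start at `x` and apply `triple_core`. [folklore] -/
theorem obstacle_noBadTriple : ∀ (A : Finset (Site 2)) (e₀ : Site 2 × ODir) (N : ℕ) {u v : Site 2} (r : (zdGraph 2).Walk u v) (Rbig : ℤ) (u₁ v₁ : Site 2) (εu : (zdGraph 2).Walk u u₁) (εv : (zdGraph 2).Walk v v₁) (x y z mx my' mz : ℕ), IsBEdge (↑A : Set (Site 2)) e₀ → 0 < N → btour (↑A : Set (Site 2)) e₀ N = e₀ → (∀ j j', j < N → j' < N → btour (↑A : Set (Site 2)) e₀ j = btour (↑A : Set (Site 2)) e₀ j' → j = j') → r.IsPath → 2 ≤ r.length → (∀ x' ∈ A, ∀ y' ∈ A, ∃ w : (zdGraph 2).Walk x' y', ∀ z' ∈ w.support, z' ∈ A) → (∀ z' ∈ r.support, z' ∉ A) → (∀ z' : Site 2, (z' ∈ A ∨ z' ∈ r.support) → z' 0 + 2 ≤ Rbig) → Rbig ≤ u₁ 0 → Rbig ≤ v₁ 0 → (∀ z' ∈ εu.support, z' ∉ A ∧ ∀ n, 0 < n → n < r.length → z' ≠ r.getVert n) → (∀ z' ∈ εv.support, z' ∉ A ∧ ∀ n,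 0 < n → n < r.length → z' ≠ r.getVert n) → (∀ c : Site 2, c ∉ A → (∀ n, 0 < n → n < r.length → c ≠ r.getVert n) → (∃ a ∈ A, (zdGraph 2).Adj a c) → ∃ (c' : Site 2) (ε : (zdGraph 2).Walk c c'), Rbig ≤ c' 0 ∧ ∀ z' ∈ ε.support, z' ∉ A ∧ ∀ n, 0 < n → n < r.length → z' ≠ r.getVert n) → (∀ (k n n' : ℕ), 0 < n → n < r.length → 0 < n' → n' < r.length → bcontact (btour (↑A : Set (Site 2)) e₀ k) = r.getVert n → bcontact (btour (↑A : Set (Site 2)) e₀ (k + 1)) = r.getVert n' → (n ≤ n' ∨ (n + 1 = r.length ∧ n' + 2 ≤ n ∧ ∃ f ∈ A, ∃ d : ODir, r.getVert n = f + d.vec ∧ r.getVert n' = f + d.ccw.vec ∧ r.getVert r.length = f + d.vec + d.ccw.vec ∧ r.getVert (n' - 1) = r.getVert n' + d.ccw.vec) ∨ (n' = 1 ∧ 3 ≤ n ∧ ∃ f ∈ A, ∃ d : ODir, r.getVert n = f + d.vec ∧ r.getVert 1 = f + d.ccw.vec ∧ r.getVert 0 = f + d.vec + d.ccw.vec ∧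 r.getVert (n + 1) = r.getVert n + d.vec))) → x < y → y < z → z < x + N → 0 < mx → mx < r.length → 0 < my' → my' < r.length → 0 < mz → mz < r.length → bcontact (btour (↑A : Set (Site 2)) e₀ x) = r.getVert mx → bcontact (btour (↑A : Set (Site 2)) e₀ y) = r.getVert my' → bcontact (btour (↑A : Set (Site 2)) e₀ z) = r.getVert mz → mx < mz → (my' < mx ∨ mz < my') → False := by
  intro A e₀ N u v r Rbig u₁ v₁ εu εv x y z mx my' mz he₀ hNpos hN hinj hr _ hA hrA hR hu₁ hv₁ hεu hεv hesc hstep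
    hxy hyz hzx hmx _ hmy'0 hmy'L _ hmzL hx hy hz hxz hmy'
  -- shift the start of the period to the first position of the triple
  have hshift : ∀ k, btour (↑A : Set (Site 2)) (btour (↑A : Set (Site 2)) e₀ x) k =
      btour (↑A : Set (Site 2)) e₀ (x + k) := fun k => (btour_add _ e₀ x k).symm
  refine triple_core A (btour (↑A : Set (Site 2)) e₀ x) N r Rbig u₁ v₁ εu εv (y - x) (z - x) mx my' mz
    (btour_isBEdge _ he₀ x) ?_ ?_ hr hA hrA hR hu₁ hv₁ hεu hεv hesc ?_ (by omega) (by omega) (by omega) hmx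
    hmy'0 hmy'L hmzL hx ?_ ?_ hxz hmy'
  · rw [hshift, btour_add_of_eq _ hN]
  · intro j j' hj hj' h
    rw [hshift, hshift, ← btour_mod_of_eq _ hN (x + j), ← btour_mod_of_eq _ hN (x + j')] at h
    have hmod : j % N = j' % N :=
      Nat.ModEq.add_left_cancel' x (hinj _ _ (Nat.mod_lt _ hNpos) (Nat.mod_lt _ hNpos) h)
    rwa [Nat.mod_eq_of_lt hj, Nat.mod_eq_of_lt hj'] at hmod
  · intro k n n' hn0 hnL hn'0 hn'L hk hk1
    rw [hshift] at hk hk1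
    rw [← add_assoc] at hk1
    exact hstep (x + k) n n' hn0 hnL hn'0 hn'L hk hk1
  · rw [hshift, show x + (y - x) = y by omega]
    exact hy
  · rw [hshift, show x + (z - x) = z by omega]
    exact hz

end Summit.CriticalPhenomena.SAWScalingLimit.Theorems.FKGToTraversalBound.SlitNecklace

end
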